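import Mathlib
import Summits.ResolutionOfSingularities.ResolutionOfSingularities.Theorems.WeightedInvariantLocalWeightedDropTOT2CurveSwap
import Summits.ResolutionOfSingularities.ResolutionOfSingularities.Theorems.WeightedInvariantLocalWeightedDropWildMonicFlagTripleBasic

/-!
# `LocalWeightedDrop`, NC count game — TOT2-LINE piece S-CRV (v1.3 (P3)/(B3)): `u₂`-GRAPHS UNDER RE-CENTRING — F2 conjugated by the swap

[OURS · L1 W4.3 · chain w43, engine crux `LocalWeightedDrop` stmt-ResolutionOfSingularities-8899; piece S-CRV / (P3) = res-type-088; `--supports 8899 --as helper`,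
counted 0; definition-free; nothing here is a statement of any manuscript; AI-written (gate-accepted = sorry-free with standard axioms, not refereed).]

Re-centrings `y ↦ y + ψ₀(u)` commute with the swap `Â = (j ↦ A_j(u₂,u₁))` (`WildMonic.subst_shift`): `(shift d A ψ₀)^ = shift d Â ψ₀^`.  Hence the
`u₂`-graph data of a label (the `u₁`-graph data of `Â`) survive every preparing re-centring, exactly as the `u₁`-graph data do (F2):
`swap_shift`, `constantCoeff_subst_swap`, **`isPermissibleTwoT_swap_graph_recentre`**, `hasGraphCurveT_swap_shift`.
-/

set_option linter.dupNamespace false -- mandated namespace of this single-conjunct summit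

noncomputable section

namespace Summit.ResolutionOfSingularities.ResolutionOfSingularities.Theorems

namespace TOT2Curve

open MvPowerSeries PolyDescent MonicDescent WildMonic Literature.AlgebraicGeometry.Resolution

variable {k : Type} [Field k] {d : ℕ}

/-- The swap commutes with re-centrings: `(shift d A ψ₀)^ = shift d Â ψ₀^`. -/
theorem swap_shift (A : Fin d → MvPowerSeries (Fin 2) k) (ψ₀ : MvPowerSeries (Fin 2) k) :
    (fun j => subst (![X 1, X 0] : Fin 2 → MvPowerSeries (Fin 2) k) (shift d A ψ₀ j)) =
      shift d (fun i => subst (![X 1, X 0] : Fin 2 → MvPowerSeries (Fin 2) k) (A i))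
        (subst (![X 1, X 0] : Fin 2 → MvPowerSeries (Fin 2) k) ψ₀) := by
  funext j
  exact subst_shift hasSubst_swap A ψ₀ j

/-- The swap keeps the constant term. -/
theorem constantCoeff_subst_swap (F : MvPowerSeries (Fin 2) k) :
    constantCoeff (subst (![X 1, X 0] : Fin 2 → MvPowerSeries (Fin 2) k) F) = constantCoeff F := by
  rw [← coeff_zero_eq_constantCoeff_apply, coeff_subst_swap, ← coeff_zero_eq_constantCoeff_apply]
  congr 2
  refine Literature.RingTheory.TwoVariableSeries.finsupp_fin2_ext ?_ ?_
  · simp only [Finsupp.add_apply, Finsupp.single_apply]; simp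
  · simp only [Finsupp.add_apply, Finsupp.single_apply]; simp

/-- **(F2^) `u₂`-GRAPHS SURVIVE RE-CENTRINGS.**  If the swapped label carries a permissible graph branch with datum `g` and re-centring `ψ`, then
after any re-centring `y ↦ y + ψ₀(u)` of `A` the swapped label carries it with the same datum and re-centring `ψ − shear g ψ₀^`. -/
theorem isPermissibleTwoT_swap_graph_recentre (A : Fin d → MvPowerSeries (Fin 2) k) (g ψ ψ₀ : MvPowerSeries (Fin 2) k)
    (hperm : IsPermissibleTwoT d (shift d (shearT g (fun i => subst (![X 1, X 0] : Fin 2 → MvPowerSeries (Fin 2) k) (A i))) ψ)) :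
    IsPermissibleTwoT d (shift d (shearT g (fun j => subst (![X 1, X 0] : Fin 2 → MvPowerSeries (Fin 2) k) (shift d A ψ₀ j)))
      (ψ - shear g (subst (![X 1, X 0] : Fin 2 → MvPowerSeries (Fin 2) k) ψ₀))) := by
  rw [swap_shift]
  exact isPermissibleTwoT_graph_recentre g _ ψ _ hperm

/-- The predicate form: `HasGraphCurveT` of the swapped label is invariant under re-centrings of the label. -/
theorem hasGraphCurveT_swap_shift {A : Fin d → MvPowerSeries (Fin 2) k}
    (hA : HasGraphCurveT d (fun i => subst (![X 1, X 0] : Fin 2 → MvPowerSeries (Fin 2) k) (A i))) (ψ₀ : MvPowerSeries (Fin 2) k)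
    (hψ₀ : constantCoeff ψ₀ = 0) :
    HasGraphCurveT d (fun j => subst (![X 1, X 0] : Fin 2 → MvPowerSeries (Fin 2) k) (shift d A ψ₀ j)) := by
  rw [swap_shift]
  exact hasGraphCurveT_shift hA _ (by rw [constantCoeff_subst_swap]; exact hψ₀)

end TOT2Curve

end Summit.ResolutionOfSingularities.ResolutionOfSingularities.Theorems

end
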